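import Summits.NavierStokesRegularity.NavierStokesRegularity.Theorems.TerminalTraceTypeITraceScarL3LogMeanCeiling

/-!
# The thresholds `2 ≤ C²` and `1 ≤ q` of the apex calculus are SHARP for the engine
# (item `TerminalTrace.TypeITraceScarL3`, stmt-NavierStokesRegularity-18385; ROUND-34 K1; helpers)

LANDING PLATE t35 prepared by the planner-of-record nsreg-p2 g31 (cell ns-regularity-ideate, ROUND-34
«the constant in T28-C») for a PROVER seat (`--supports stmt-NavierStokesRegularity-18385 --as helper`; the
planner lands nothing, DIRECTOR-NS #100/#159/#168).  Pure real analysis, Mathlib-only through the imported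
calculus files, theorems only (0 defs, 0 facts, 0 sorries).

CONTENT.  The real-variable engines behind T27 (`typeITraceScarL3_of_eventualRate_sq_lt_two_nu`, window
`C² < 2ν`) and T28-C (`typeITraceScarL3_of_logMean_lt`, window `q < 1`) are
`two_le_rateSq_of_identities` («identity package with rate `β² ≤ C²/(−s)` ⇒ `2 ≤ C²`») and
`one_le_logMean_of_identities` («identity package with log-window means `≤ q·log + K₀` ⇒ `1 ≤ q`»).
This file shows that BOTH conclusions are attained: for every floor constant `c > 0` and every window
`s₁ < 0` the hypothesis lists are satisfied, with EQUALITY in the floor, in the rate bound and in the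
drift-pairing (Ghidaglia) bound, by the explicit Type-I-scaled self-similar data
`E(s) = c√(−s)`, `D(s) = c/(4√(−s))` (frequency `Λ = D/E = 1/(4(−s))`, the ceiling of
`frequency_logMean_le_quarter`), `Q₀(s) = 3c/(16√(−s)³)`, `X(s) = c/(4√(−s)³)`, `S₁ = S₂ = 0`,
`β(s) = √2/√(−s)` — i.e. `C = √2`; and in the log-mean form `p ≡ 1`, `P(s) = −log(−s)`, `q = 1`, `K₀ = 0`.
Consequently neither engine can yield `2 + η ≤ C²` resp. `1 + η ≤ q` for any `η > 0`
(`not_forall_identities_two_add_le_rateSq`, `not_forall_identities_one_add_le_logMean`): any improvement of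
the constant `2qν, q < 1` in T28-C (equivalently `√(2ν)` in T27) must use an input that is not in the
identity package — this is the K1 verdict «SHARP for the engine» of ROUND-34, kernel-checked.
WHAT THIS IS NOT: not a Navier–Stokes statement (the witnesses are real functions, not a flow; whether a
div-free critical drift realises them is seed s27-2, open, and inside NS it would be a Type-I blow-up);
not item 18385; not NS regularity.
[folklore; this cell's ROUND-27 §3 (backward-Gaussian sharpness of Nagumo/Ghidaglia constants), ROUND-28 §1]
-/

noncomputable section

open Set Filter Topology

set_option linter.dupNamespace false

namespace Summit.NavierStokesRegularity.NavierStokesRegularity.Theorems.TypeITraceScarL3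

/-! ### The explicit witnesses at one time `s < 0` -/

/-- `E(s) = c√(−s)` has `E' = −2D` with `D(s) = c/(4√(−s))` (energy identity with `S₁ = 0`). [folklore] -/
theorem thresholdWitness_hasDerivAt_energy (c : ℝ) {s : ℝ} (hs : s < 0) :
    HasDerivAt (fun x => c * Real.sqrt (-x)) (-2 * (c / (4 * Real.sqrt (-s))) + 2 * 0) s := by
  have hne : -s ≠ 0 := by linarith
  have hr : 0 < Real.sqrt (-s) := Real.sqrt_pos.2 (by linarith)
  have h : HasDerivAt (fun x => c * Real.sqrt (-x)) (c * (1 / (2 * Real.sqrt (-s)) * -1)) s :=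
    ((Real.hasDerivAt_sqrt hne).comp s (hasDerivAt_neg' s)).const_mul c
  convert h using 1
  field_simp
  ring

/-- `D(s) = c/(4√(−s))` has `D' = −2Q₀ + 2X` with `Q₀(s) = 3c/(16√(−s)³)`, `X(s) = c/(4√(−s)³)`
(enstrophy identity with `S₂ = 0`). [folklore] -/
theorem thresholdWitness_hasDerivAt_enstrophy (c : ℝ) {s : ℝ} (hs : s < 0) :
    HasDerivAt (fun x => c / (4 * Real.sqrt (-x)))
      (-2 * (3 * c / (16 * Real.sqrt (-s) ^ 3)) + 2 * (c / (4 * Real.sqrt (-s) ^ 3)) - 2 * 0) s := by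
  have hne : -s ≠ 0 := by linarith
  have hr : 0 < Real.sqrt (-s) := Real.sqrt_pos.2 (by linarith)
  have h4 : HasDerivAt (fun x => 4 * Real.sqrt (-x)) (4 * (1 / (2 * Real.sqrt (-s)) * -1)) s :=
    ((Real.hasDerivAt_sqrt hne).comp s (hasDerivAt_neg' s)).const_mul 4
  have h : HasDerivAt (fun x => c / (4 * Real.sqrt (-x)))
      ((0 * (4 * Real.sqrt (-s)) - c * (4 * (1 / (2 * Real.sqrt (-s)) * -1))) /
        (4 * Real.sqrt (-s)) ^ 2) s :=
    (hasDerivAt_const s c).div h4 (mul_ne_zero four_ne_zero hr.ne')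
  convert h using 1
  field_simp
  ring

/-- Cauchy–Schwarz slot `D² ≤ E·Q₀` for the witnesses (strict: `c²/16 ≤ 3c²/16`). [folklore] -/
theorem thresholdWitness_sq_le {c s : ℝ} (hs : s < 0) :
    (c / (4 * Real.sqrt (-s))) ^ 2 ≤ c * Real.sqrt (-s) * (3 * c / (16 * Real.sqrt (-s) ^ 3)) := by
  have hr : 0 < Real.sqrt (-s) := Real.sqrt_pos.2 (by linarith)
  have h : c * Real.sqrt (-s) * (3 * c / (16 * Real.sqrt (-s) ^ 3)) =
      3 * (c / (4 * Real.sqrt (-s))) ^ 2 := by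
    field_simp
    ring
  rw [h]
  nlinarith [sq_nonneg (c / (4 * Real.sqrt (-s)))]

/-- The reduced enstrophy `Q₀ − D²/E = c/(8√(−s)³)` of the witnesses. [folklore] -/
theorem thresholdWitness_reducedEnstrophy {c s : ℝ} (hc : 0 < c) (hs : s < 0) :
    3 * c / (16 * Real.sqrt (-s) ^ 3) - (c / (4 * Real.sqrt (-s))) ^ 2 / (c * Real.sqrt (-s)) =
      c / (8 * Real.sqrt (-s) ^ 3) := by
  have hr : 0 < Real.sqrt (-s) := Real.sqrt_pos.2 (by linarith)
  field_simp
  ring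

/-- EQUALITY in the drift-pairing (Ghidaglia) slot: `β√(Q₀ − D²/E)√D = X` for `β = √2/√(−s)`. [folklore] -/
theorem thresholdWitness_pairing_eq {c s : ℝ} (hc : 0 < c) (hs : s < 0) :
    Real.sqrt 2 / Real.sqrt (-s) * Real.sqrt (c / (8 * Real.sqrt (-s) ^ 3)) *
        Real.sqrt (c / (4 * Real.sqrt (-s))) = c / (4 * Real.sqrt (-s) ^ 3) := by
  have hr : 0 < Real.sqrt (-s) := Real.sqrt_pos.2 (by linarith)
  have hA : 0 ≤ c / (8 * Real.sqrt (-s) ^ 3) := by positivity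
  have h2A : (0 : ℝ) ≤ 2 * (c / (8 * Real.sqrt (-s) ^ 3)) := by positivity
  have hsq : 2 * (c / (8 * Real.sqrt (-s) ^ 3)) * (c / (4 * Real.sqrt (-s))) =
      (c / (4 * Real.sqrt (-s) ^ 2)) ^ 2 := by
    field_simp
    ring
  calc Real.sqrt 2 / Real.sqrt (-s) * Real.sqrt (c / (8 * Real.sqrt (-s) ^ 3)) *
        Real.sqrt (c / (4 * Real.sqrt (-s)))
        = Real.sqrt 2 * Real.sqrt (c / (8 * Real.sqrt (-s) ^ 3)) *
            Real.sqrt (c / (4 * Real.sqrt (-s))) / Real.sqrt (-s) := by ring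
    _ = Real.sqrt (2 * (c / (8 * Real.sqrt (-s) ^ 3)) * (c / (4 * Real.sqrt (-s)))) /
            Real.sqrt (-s) := by
          rw [← Real.sqrt_mul (by norm_num : (0 : ℝ) ≤ 2), ← Real.sqrt_mul h2A]
    _ = c / (4 * Real.sqrt (-s) ^ 2) / Real.sqrt (-s) := by
          rw [hsq, Real.sqrt_sq (by positivity)]
    _ = c / (4 * Real.sqrt (-s) ^ 3) := by
          field_simp

/-- The drift-pairing hypothesis `|X| ≤ β√(Q₀ − D²/E)√D` holds (with equality) for the witnesses. [folklore] -/
theorem thresholdWitness_pairing_le {c s : ℝ} (hc : 0 < c) (hs : s < 0) :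
    |c / (4 * Real.sqrt (-s) ^ 3)| ≤
      Real.sqrt 2 / Real.sqrt (-s) *
          Real.sqrt (3 * c / (16 * Real.sqrt (-s) ^ 3) -
            (c / (4 * Real.sqrt (-s))) ^ 2 / (c * Real.sqrt (-s))) *
        Real.sqrt (c / (4 * Real.sqrt (-s))) := by
  have hr : 0 < Real.sqrt (-s) := Real.sqrt_pos.2 (by linarith)
  rw [thresholdWitness_reducedEnstrophy hc hs, thresholdWitness_pairing_eq hc hs,
    abs_of_nonneg (by positivity)]

/-- EQUALITY in the rate slot: `β² = (√2)²/(−s)` for `β = √2/√(−s)`. [folklore] -/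
theorem thresholdWitness_rate_sq {s : ℝ} (hs : s < 0) :
    (Real.sqrt 2 / Real.sqrt (-s)) ^ 2 = Real.sqrt 2 ^ 2 / (-s) := by
  rw [div_pow, Real.sq_sqrt (by linarith : (0 : ℝ) ≤ -s)]

/-- Extinction `E(s) = c√(−s) → 0` as `s → 0⁻`. [folklore] -/
theorem thresholdWitness_extinction (c : ℝ) :
    Tendsto (fun x => c * Real.sqrt (-x)) (𝓝[<] (0 : ℝ)) (𝓝 0) := by
  have hc : Continuous fun x : ℝ => c * Real.sqrt (-x) :=
    continuous_const.mul (Real.continuous_sqrt.comp continuous_neg)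
  have h := hc.tendsto 0
  simp only [neg_zero, Real.sqrt_zero, mul_zero] at h
  exact h.mono_left nhdsWithin_le_nhds

/-- `P(s) = −log(−s)` has `P' = p/(−s)` with `p ≡ 1` (the log-window primitive at `q = 1`). [folklore] -/
theorem thresholdWitness_hasDerivAt_logPrimitive {s : ℝ} (hs : s < 0) :
    HasDerivAt (fun x => -Real.log (-x)) ((1 : ℝ) / (-s)) s := by
  have hne : -s ≠ 0 := by linarith
  have h : HasDerivAt (fun x => -Real.log (-x)) (-((-s)⁻¹ * -1)) s :=
    ((Real.hasDerivAt_log hne).comp s (hasDerivAt_neg' s)).neg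
  convert h using 1
  field_simp

/-- The log-window bound at `q = 1`, `K₀ = 0`, with equality: `P(s) − P(s') = log((−s')/(−s))`. [folklore] -/
theorem thresholdWitness_logWindow {s' s : ℝ} (hs' : s' < 0) (hs : s < 0) :
    -Real.log (-s) - -Real.log (-s') ≤ 1 * Real.log (-s' / -s) + 0 := by
  rw [one_mul, add_zero, Real.log_div (by linarith) (by linarith)]
  linarith

/-! ### Satisfiability of the two hypothesis packages at the threshold values -/

/-- **The hypotheses of `two_le_rateSq_of_identities` are satisfiable with `C = √2`** (any floor constant
`c > 0`, any window endpoint `s₁`, no shell sources `m₁ = m₂ = 0`), by the self-similar Type-I-scaled data of the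
module docstring; so its conclusion `2 ≤ C²` is attained. [folklore; ROUND-34 K1] -/
theorem identities_satisfiable_at_sqrt_two {c : ℝ} (hc : 0 < c) (s₁ : ℝ) :
    ∃ (E D Q₀ S₁ S₂ X β : ℝ → ℝ),
      (∀ s ∈ Ioo s₁ 0, c * Real.sqrt (-s) ≤ E s) ∧
      (∀ s ∈ Ioo s₁ 0, 0 ≤ D s) ∧
      (∀ s ∈ Ioo s₁ 0, D s ^ 2 ≤ E s * Q₀ s) ∧
      (∀ s ∈ Ioo s₁ 0, HasDerivAt E (-2 * D s + 2 * S₁ s) s) ∧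
      (∀ s ∈ Ioo s₁ 0, HasDerivAt D (-2 * Q₀ s + 2 * X s - 2 * S₂ s) s) ∧
      (∀ s ∈ Ioo s₁ 0, |S₁ s| ≤ 0) ∧ (∀ s ∈ Ioo s₁ 0, |S₂ s| ≤ 0) ∧
      (∀ s ∈ Ioo s₁ 0, 0 ≤ β s ∧ β s ^ 2 ≤ Real.sqrt 2 ^ 2 / (-s)) ∧
      (∀ s ∈ Ioo s₁ 0, |X s| ≤ β s * Real.sqrt (Q₀ s - D s ^ 2 / E s) * Real.sqrt (D s)) ∧
      Tendsto E (𝓝[<] 0) (𝓝 0) := by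
  refine ⟨fun s => c * Real.sqrt (-s), fun s => c / (4 * Real.sqrt (-s)),
    fun s => 3 * c / (16 * Real.sqrt (-s) ^ 3), fun _ => 0, fun _ => 0,
    fun s => c / (4 * Real.sqrt (-s) ^ 3), fun s => Real.sqrt 2 / Real.sqrt (-s),
    fun s _ => le_rfl, fun s hs => ?_, fun s hs => thresholdWitness_sq_le hs.2,
    fun s hs => thresholdWitness_hasDerivAt_energy c hs.2,
    fun s hs => thresholdWitness_hasDerivAt_enstrophy c hs.2,
    fun s _ => by simp, fun s _ => by simp,
    fun s hs => ⟨by positivity, (thresholdWitness_rate_sq hs.2).le⟩,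
    fun s hs => thresholdWitness_pairing_le hc hs.2, thresholdWitness_extinction c⟩
  have hr : 0 < Real.sqrt (-s) := Real.sqrt_pos.2 (by linarith [hs.2])
  positivity

/-- **The hypotheses of `one_le_logMean_of_identities` are satisfiable with `q = 1`, `K₀ = 0`** (any
`c > 0`, any `s₁`, `m₁ = m₂ = 0`), by the same data with `p ≡ 1`, `P(s) = −log(−s)`; so its conclusion
`1 ≤ q` is attained. [folklore; ROUND-34 K1] -/
theorem logMeanIdentities_satisfiable_at_one {c : ℝ} (hc : 0 < c) (s₁ : ℝ) :
    ∃ (E D Q₀ S₁ S₂ X β p P : ℝ → ℝ),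
      (∀ s ∈ Ioo s₁ 0, c * Real.sqrt (-s) ≤ E s) ∧
      (∀ s ∈ Ioo s₁ 0, 0 ≤ D s) ∧
      (∀ s ∈ Ioo s₁ 0, D s ^ 2 ≤ E s * Q₀ s) ∧
      (∀ s ∈ Ioo s₁ 0, HasDerivAt E (-2 * D s + 2 * S₁ s) s) ∧
      (∀ s ∈ Ioo s₁ 0, HasDerivAt D (-2 * Q₀ s + 2 * X s - 2 * S₂ s) s) ∧
      (∀ s ∈ Ioo s₁ 0, |S₁ s| ≤ 0) ∧ (∀ s ∈ Ioo s₁ 0, |S₂ s| ≤ 0) ∧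
      (∀ s ∈ Ioo s₁ 0, 0 ≤ p s) ∧
      (∀ s ∈ Ioo s₁ 0, HasDerivAt P (p s / (-s)) s) ∧
      (∀ s' ∈ Ioo s₁ 0, ∀ s ∈ Ioo s₁ 0, s' ≤ s → P s - P s' ≤ 1 * Real.log ((-s') / (-s)) + 0) ∧
      (∀ s ∈ Ioo s₁ 0, 0 ≤ β s ∧ β s ^ 2 ≤ 2 * p s / (-s)) ∧
      (∀ s ∈ Ioo s₁ 0, |X s| ≤ β s * Real.sqrt (Q₀ s - D s ^ 2 / E s) * Real.sqrt (D s)) ∧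
      Tendsto E (𝓝[<] 0) (𝓝 0) := by
  refine ⟨fun s => c * Real.sqrt (-s), fun s => c / (4 * Real.sqrt (-s)),
    fun s => 3 * c / (16 * Real.sqrt (-s) ^ 3), fun _ => 0, fun _ => 0,
    fun s => c / (4 * Real.sqrt (-s) ^ 3), fun s => Real.sqrt 2 / Real.sqrt (-s),
    fun _ => 1, fun s => -Real.log (-s),
    fun s _ => le_rfl, fun s hs => ?_, fun s hs => thresholdWitness_sq_le hs.2,
    fun s hs => thresholdWitness_hasDerivAt_energy c hs.2,
    fun s hs => thresholdWitness_hasDerivAt_enstrophy c hs.2,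
    fun s _ => by simp, fun s _ => by simp, fun s _ => zero_le_one,
    fun s hs => thresholdWitness_hasDerivAt_logPrimitive hs.2,
    fun s' hs' s hs _ => thresholdWitness_logWindow hs'.2 hs.2,
    fun s hs => ⟨by positivity, ?_⟩,
    fun s hs => thresholdWitness_pairing_le hc hs.2, thresholdWitness_extinction c⟩
  · have hr : 0 < Real.sqrt (-s) := Real.sqrt_pos.2 (by linarith [hs.2])
    positivity
  · rw [thresholdWitness_rate_sq hs.2, Real.sq_sqrt (by norm_num : (0 : ℝ) ≤ 2), mul_one]

/-! ### The thresholds cannot be improved by the engines -/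

/-- **`2 ≤ C²` is sharp for `two_le_rateSq_of_identities`**: for no `η > 0` does the identity package force
`2 + η ≤ C²` (same binders verbatim, conclusion strengthened) — instantiate at the witnesses with `C = √2`.
Hence the window `C² < 2ν` of T27 / `q < 1` of T28-C is the engine's exact reach. [folklore; ROUND-34 K1] -/
theorem not_forall_identities_two_add_le_rateSq {η : ℝ} (hη : 0 < η) :
    ¬ (∀ (C c m₁ m₂ s₁ : ℝ) (E D Q₀ S₁ S₂ X β : ℝ → ℝ),
        s₁ < 0 → 0 < c → 0 ≤ m₁ → 0 ≤ m₂ →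
        (∀ s ∈ Ioo s₁ 0, c * Real.sqrt (-s) ≤ E s) →
        (∀ s ∈ Ioo s₁ 0, 0 ≤ D s) →
        (∀ s ∈ Ioo s₁ 0, D s ^ 2 ≤ E s * Q₀ s) →
        (∀ s ∈ Ioo s₁ 0, HasDerivAt E (-2 * D s + 2 * S₁ s) s) →
        (∀ s ∈ Ioo s₁ 0, HasDerivAt D (-2 * Q₀ s + 2 * X s - 2 * S₂ s) s) →
        (∀ s ∈ Ioo s₁ 0, |S₁ s| ≤ m₁) → (∀ s ∈ Ioo s₁ 0, |S₂ s| ≤ m₂) →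
        (∀ s ∈ Ioo s₁ 0, 0 ≤ β s ∧ β s ^ 2 ≤ C ^ 2 / (-s)) →
        (∀ s ∈ Ioo s₁ 0, |X s| ≤ β s * Real.sqrt (Q₀ s - D s ^ 2 / E s) * Real.sqrt (D s)) →
        Tendsto E (𝓝[<] 0) (𝓝 0) → 2 + η ≤ C ^ 2) := by
  intro h
  obtain ⟨E, D, Q₀, S₁, S₂, X, β, hfloor, hDnn, hCS, hE, hD, hS₁, hS₂, hβ, hX, hext⟩ :=
    identities_satisfiable_at_sqrt_two one_pos (-1)
  have h2 := h (Real.sqrt 2) 1 0 0 (-1) E D Q₀ S₁ S₂ X β (by norm_num) one_pos le_rfl le_rfl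
    hfloor hDnn hCS hE hD hS₁ hS₂ hβ hX hext
  rw [Real.sq_sqrt (by norm_num : (0 : ℝ) ≤ 2)] at h2
  linarith

/-- **`1 ≤ q` is sharp for `one_le_logMean_of_identities`**: for no `η > 0` does the log-mean identity
package force `1 + η ≤ q` (same binders verbatim, conclusion strengthened) — instantiate at the witnesses
with `q = 1`, `K₀ = 0`.  Hence the hypothesis `q < 1` of T28-C (`typeITraceScarL3_of_logMean_lt`, threshold
`2qν`) cannot be relaxed through this engine. [folklore; ROUND-34 K1] -/
theorem not_forall_identities_one_add_le_logMean {η : ℝ} (hη : 0 < η) :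
    ¬ (∀ (q K₀ c m₁ m₂ s₁ : ℝ) (E D Q₀ S₁ S₂ X β p P : ℝ → ℝ),
        s₁ < 0 → 0 < c → 0 ≤ m₁ → 0 ≤ m₂ → 0 ≤ K₀ →
        (∀ s ∈ Ioo s₁ 0, c * Real.sqrt (-s) ≤ E s) →
        (∀ s ∈ Ioo s₁ 0, 0 ≤ D s) →
        (∀ s ∈ Ioo s₁ 0, D s ^ 2 ≤ E s * Q₀ s) →
        (∀ s ∈ Ioo s₁ 0, HasDerivAt E (-2 * D s + 2 * S₁ s) s) →
        (∀ s ∈ Ioo s₁ 0, HasDerivAt D (-2 * Q₀ s + 2 * X s - 2 * S₂ s) s) →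
        (∀ s ∈ Ioo s₁ 0, |S₁ s| ≤ m₁) → (∀ s ∈ Ioo s₁ 0, |S₂ s| ≤ m₂) →
        (∀ s ∈ Ioo s₁ 0, 0 ≤ p s) →
        (∀ s ∈ Ioo s₁ 0, HasDerivAt P (p s / (-s)) s) →
        (∀ s' ∈ Ioo s₁ 0, ∀ s ∈ Ioo s₁ 0, s' ≤ s →
          P s - P s' ≤ q * Real.log ((-s') / (-s)) + K₀) →
        (∀ s ∈ Ioo s₁ 0, 0 ≤ β s ∧ β s ^ 2 ≤ 2 * p s / (-s)) →
        (∀ s ∈ Ioo s₁ 0, |X s| ≤ β s * Real.sqrt (Q₀ s - D s ^ 2 / E s) * Real.sqrt (D s)) →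
        Tendsto E (𝓝[<] 0) (𝓝 0) → 1 + η ≤ q) := by
  intro h
  obtain ⟨E, D, Q₀, S₁, S₂, X, β, p, P, hfloor, hDnn, hCS, hE, hD, hS₁, hS₂, hpnn, hP, hwin, hβ, hX,
      hext⟩ :=
    logMeanIdentities_satisfiable_at_one one_pos (-1)
  have h1 := h 1 0 1 0 0 (-1) E D Q₀ S₁ S₂ X β p P (by norm_num) one_pos le_rfl le_rfl le_rfl
    hfloor hDnn hCS hE hD hS₁ hS₂ hpnn hP hwin hβ hX hext
  linarith

/-- **Consistency check against the engines themselves**: fed with the witnesses, `two_le_rateSq_of_identities`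
returns `2 ≤ (√2)²` and `one_le_logMean_of_identities` returns `1 ≤ 1` — the two tree theorems are invoked
BY NAME on the sharp data (so the binder lists above are literally theirs). [folklore; ROUND-34 K1] -/
theorem thresholdWitness_engines_apply :
    (2 : ℝ) ≤ Real.sqrt 2 ^ 2 ∧ (1 : ℝ) ≤ 1 := by
  obtain ⟨E, D, Q₀, S₁, S₂, X, β, hfloor, hDnn, hCS, hE, hD, hS₁, hS₂, hβ, hX, hext⟩ :=
    identities_satisfiable_at_sqrt_two one_pos (-1)
  obtain ⟨E', D', Q₀', S₁', S₂', X', β', p, P, hfloor', hDnn', hCS', hE', hD', hS₁', hS₂', hpnn, hP, hwin,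
      hβ', hX', hext'⟩ :=
    logMeanIdentities_satisfiable_at_one one_pos (-1)
  exact ⟨two_le_rateSq_of_identities (by norm_num) one_pos le_rfl le_rfl hfloor hDnn hCS hE hD hS₁ hS₂
      hβ hX hext,
    one_le_logMean_of_identities (by norm_num) one_pos le_rfl le_rfl le_rfl hfloor' hDnn' hCS' hE' hD'
      hS₁' hS₂' hpnn hP hwin hβ' hX' hext'⟩

end Summit.NavierStokesRegularity.NavierStokesRegularity.Theorems.TypeITraceScarL3
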